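import Literature.AlgebraicGeometry.Hyperkaehler.GeneralizedKummerType
import Literature.AlgebraicGeometry.HodgeTheory.LefschetzStandardConjectureFacts
import Literature.AlgebraicGeometry.HodgeTheory.MotivatedClassesAssembly
import Literature.AlgebraicGeometry.HodgeTheory.ComplexConjugationHolds
import HarnessLib

/-!
# Hodge classes on projective hyperkähler varieties of `K3^[n]`- and `Kumⁿ`-type are motivated (hence absolute Hodge) — NAMED FACT

Layer `Literature/AlgebraicGeometry/Hyperkaehler`.  CITE record owed by the Hodge-ladder stage-4
scoping (run/shared/lean/pub/hodge-director/STAGE4-ABELIAN-MOTIVIC-TYPE.md §2/§10: "Soldatenkov 2022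
Cor. 1.2 in its Hodge-side shadow"): the André motive of a projective hyperkähler manifold of
`K3^[n]`-, generalized-Kummer- or OG6-type is ABELIAN (Soldatenkov, Cor. 1.2), hence all its Hodge
classes are MOTIVATED (André 1996, as quoted by Soldatenkov §2.2) and therefore ABSOLUTE HODGE
(Soldatenkov, Cor. 1.3).  This is the input of road (R1) of the scoping document for row 2: together
with Grothendieck's `B` for all smooth projective complex varieties it yields the Hodge conjecture for
these varieties through the tree's assembly
`HodgeTheory.Andre1996_motivatedClasses_le_algebraicClasses_of_standardConjectureB_holds_of`.

## Source (read: arXiv text `paper:arxiv-1904.11320`)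

A. Soldatenkov, *Deformation principle and André motives of projective hyperkähler manifolds*, Int.
Math. Res. Not. IMRN 2022, no. 21, 16814–16843 (arXiv:1904.11320):
* Theorem 1.1 (§1.1): "Let `X₁` and `X₂` be deformation equivalent projective hyperkähler manifolds.
  The André motive of `X₁` is abelian if and only if the André motive of `X₂` is abelian."
* Corollary 1.2 (§1.1): "Let `X` be a projective hyperkähler manifold of `K3^[n]`, generalized Kummer,
  or OG6 deformation type. Then the André motive of `X` is abelian."  (Proof: "it suffices to find one
  manifold with abelian motive in each deformation class. For the Hilbert schemes of points on K3
  surfaces and generalized Kummer varieties, the motives are abelian by [de Cataldo–Migliorini 2002,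
  2004] and [Xu]. For OG6 […] [Mongardi–Rapagnetta–Saccà].")
* §2.2: "The subcategory of abelian motives `M_ab` is the minimal full Tannakian subcategory of `M_mot`
  containing `M(A)(n)` for all abelian varieties `A` and `n ∈ ℤ`. It is shown in [André 1996] that for
  any `X`, if `M(X) ∈ M_ab`, then all Hodge classes on `X` are motivated, in particular absolute Hodge."
  (André 1996, Publ. Math. IHÉS 83, §6.3 p. 31: "le foncteur « réalisation de Betti–Hodge » de
  `M(Ab)_V` vers la catégorie des `ℚ`-structures de Hodge est pleinement fidèle", with Thm. 0.6.2 and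
  Prop. 2.5.1.)
* Corollary 1.3 (§1.2): "Let `X` be a projective hyperkähler manifold of `K3^[n]`, generalized Kummer,
  or OG6 deformation type. Then all Hodge classes on `X` are absolute."  (Proof: "By Corollary 1.2, the
  André motive of `X` is abelian, and we can apply [André 1996].")

## Rendering (tree carriers) and faithfulness

* Deformation types: `IsOfK3HilbertType n X` (file `K3HilbertType`) and `IsOfGeneralizedKummerType n X`
  (file `GeneralizedKummerType`), with the companion hypothesis `Motives.IsSmoothProjective (2 * n) X`
  ("projective hyperkähler manifold").  The OG6 clause is NOT recorded: the tree's `IsOfOGradySixType K X`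
  is relative to a hypothesis structure `K : OGradySixReference` which (by that file's own account)
  over-generalises to hypothetical deformation types with the same invariants, so a statement over all
  such `K` would claim more than print.
* "all Hodge classes on `X` are motivated": every rational class of Hodge type `(p, p)` in
  `H²ᵖ(X(ℂ); ℂ)` lies in `HodgeTheory.motivatedClasses (2 * n) X p` — André's `A_motᵖ(X)_ℂ` modelled on
  ALL smooth projective complex varieties (file `HodgeTheory/MotivatedClasses`).  Soldatenkov's André
  motives are modelled on the same class (§2.1: `Var_ℂ` = smooth projective varieties over `ℂ`); a class
  motivated with respect to a smaller family of base pieces is motivated with respect to a larger one,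
  so nothing is lost in either direction of reading.
* "absolute": the tree's `HodgeTheory.IsAbsoluteHodgeClass (2 * n) X p c` (Charles–Schnell Def. 11.2.3,
  the de Rham formulation of Deligne 1982 Def. 2.10, which is Soldatenkov's §1.2 definition).  Corollary
  1.3 is DERIVED below (`hodgeClasses_absoluteHodge_of`) from the motivated statement and the tree's
  named fact `HodgeTheory.Andre1996_isAbsoluteHodgeClass_of_mem_motivatedClasses` (André Prop. 2.5.1),
  which is exactly Soldatenkov's printed proof; it is therefore not a second named fact.

## What is NOT here

André motives as a category (the statement "`M(X)` is abelian" itself); the OG6 and OG10 cases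
(Mongardi–Rapagnetta–Saccà; Floccari–Fu–Zhang); Theorem 1.1 (deformation principle); any proof.
-/

noncomputable section

namespace Literature.AlgebraicGeometry.Hyperkaehler

/-- **Soldatenkov 2022, Cor. 1.2 with §2.2 (André 1996): every Hodge class on a projective hyperkähler
manifold of `K3^[n]`-type or of generalized Kummer type is MOTIVATED.**  Cor. 1.2: "Let `X` be a
projective hyperkähler manifold of `K3^[n]`, generalized Kummer, or OG6 deformation type. Then the André
motive of `X` is abelian."; §2.2: "It is shown in [André 1996] that for any `X`, if `M(X) ∈ M_ab`, then
all Hodge classes on `X` are motivated, in particular absolute Hodge."  Rendering (module docstring):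
for `X` smooth projective of dimension `2n` over `ℂ` which is of `K3^[n]`-type (`IsOfK3HilbertType n X`)
or of `Kumⁿ`-type (`IsOfGeneralizedKummerType n X`), every rational class `c ∈ H²ᵖ(X(ℂ); ℂ)` of Hodge
type `(p, p)` lies in André's `motivatedClasses (2 * n) X p`.  OG6 omitted (module docstring).  A
THEOREM in print, unproved in the tree. [cite: Soldatenkov2022, Cor. 1.2 (§1.1) and §2.2]
[cite: Andre1996Motifs, Thm. 0.6.2 (p. 9) and §6.3 (p. 31)] -/
def Soldatenkov2022_hodgeClasses_motivated_K3HilbertType_or_kummerType : Prop :=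
  ∀ (n : ℕ) ⦃X : Motives.SchemeOver ℂ⦄, Motives.IsSmoothProjective (2 * n) X →
    (IsOfK3HilbertType n X ∨ IsOfGeneralizedKummerType n X) →
      ∀ (p : ℕ) (c : HodgeTheory.complexBetti X (2 * p)), HodgeTheory.IsRationalClass c →
        HodgeTheory.IsOfHodgeType (2 * n) X (2 * p) p p c → c ∈ HodgeTheory.motivatedClasses (2 * n) X p

namespace Soldatenkov2022_hodgeClasses_motivated_K3HilbertType_or_kummerType

/-- The `K3^[n]`-type clause. [cite: Soldatenkov2022, Cor. 1.2 (§1.1) and §2.2] -/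
theorem of_isOfK3HilbertType (h : Soldatenkov2022_hodgeClasses_motivated_K3HilbertType_or_kummerType)
    {n : ℕ} {X : Motives.SchemeOver ℂ} (hX : Motives.IsSmoothProjective (2 * n) X)
    (hK : IsOfK3HilbertType n X) (p : ℕ) (c : HodgeTheory.complexBetti X (2 * p))
    (hc : HodgeTheory.IsRationalClass c) (hpp : HodgeTheory.IsOfHodgeType (2 * n) X (2 * p) p p c) :
    c ∈ HodgeTheory.motivatedClasses (2 * n) X p :=
  h n hX (Or.inl hK) p c hc hpp

/-- The `Kumⁿ`-type clause. [cite: Soldatenkov2022, Cor. 1.2 (§1.1) and §2.2] -/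
theorem of_isOfGeneralizedKummerType
    (h : Soldatenkov2022_hodgeClasses_motivated_K3HilbertType_or_kummerType)
    {n : ℕ} {X : Motives.SchemeOver ℂ} (hX : Motives.IsSmoothProjective (2 * n) X)
    (hK : IsOfGeneralizedKummerType n X) (p : ℕ) (c : HodgeTheory.complexBetti X (2 * p))
    (hc : HodgeTheory.IsRationalClass c) (hpp : HodgeTheory.IsOfHodgeType (2 * n) X (2 * p) p p c) :
    c ∈ HodgeTheory.motivatedClasses (2 * n) X p :=
  h n hX (Or.inr hK) p c hc hpp

/-- **Soldatenkov 2022, Cor. 1.3 (derived, as in print): all Hodge classes on a projective hyperkähler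
manifold of `K3^[n]`- or `Kumⁿ`-type are ABSOLUTE HODGE** — "By Corollary 1.2, the André motive of `X`
is abelian, and we can apply [André 1996]": here, the motivated statement composed with the tree's
named fact `HodgeTheory.Andre1996_isAbsoluteHodgeClass_of_mem_motivatedClasses` (André 1996 Prop. 2.5.1:
rational motivated classes are absolute Hodge). [cite: Soldatenkov2022, Cor. 1.3 (§1.2)]
[cite: Andre1996Motifs, Prop. 2.5.1 (p. 18)] -/
theorem hodgeClasses_absoluteHodge_of
    (h : Soldatenkov2022_hodgeClasses_motivated_K3HilbertType_or_kummerType)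
    (hA : HodgeTheory.Andre1996_isAbsoluteHodgeClass_of_mem_motivatedClasses)
    {n : ℕ} {X : Motives.SchemeOver ℂ} (hX : Motives.IsSmoothProjective (2 * n) X)
    (hK : IsOfK3HilbertType n X ∨ IsOfGeneralizedKummerType n X) (p : ℕ)
    (c : HodgeTheory.complexBetti X (2 * p)) (hc : HodgeTheory.IsRationalClass c)
    (hpp : HodgeTheory.IsOfHodgeType (2 * n) X (2 * p) p p c) :
    HodgeTheory.IsAbsoluteHodgeClass (2 * n) X p c :=
  hA hX p c hc (h n hX hK p c hc hpp)

/-- **Road (R1) of the stage-4 scoping, kernel-typed: Grothendieck's `B` (algebraicity of `*_L`) for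
ALL smooth projective complex varieties ⟹ every rational `(p,p)`-class on every projective `K3^[n]`-
or `Kumⁿ`-type variety is algebraic (the tree's per-variety Hodge statement)**,
GIVEN this file's fact (Hodge ⟹ motivated on such `X`) and the multiplicativity of algebraic classes
(`HodgeTheory.Voisin2003_cupProduct_algebraicClasses`, Voisin II Prop. 9.20): a rational `(p,p)`-class is
motivated, hence algebraic under `B` by the tree's PROVED assembly of `HodgeTheory/MotivatedClassesAssembly`
(André 1996 §0.3 / §2.1 made explicit: under `B`, motivated ⊆ algebraic); Hodge models exist (`HodgeTheory.nonempty_hodgeModel_holds`).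
Algebraicity of Hodge classes on abelian varieties is NOT an input of this road.
[cite: Andre1996Motifs, §0.3 (p. 7) and §2.1 remark following Déf. 1 (p. 14)]
[cite: Soldatenkov2022, Cor. 1.2 (§1.1) and §2.2] -/
theorem hodgeClasses_algebraic_of_lefschetzStandardB
    (h : Soldatenkov2022_hodgeClasses_motivated_K3HilbertType_or_kummerType)
    (hcup : HodgeTheory.Voisin2003_cupProduct_algebraicClasses)
    (hB : ∀ (d : ℕ) (Z : Motives.SchemeOver ℂ) (η : HodgeTheory.complexBetti Z 2),
      Motives.IsSmoothProjective d Z → HodgeTheory.StandardConjectureBStar d Z η)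
    {n : ℕ} {X : Motives.SchemeOver ℂ} (hX : Motives.IsSmoothProjective (2 * n) X)
    (hK : IsOfK3HilbertType n X ∨ IsOfGeneralizedKummerType n X) :
    HodgeTheory.HodgeConjectureFor (2 * n) X :=
  ⟨HodgeTheory.nonempty_hodgeModel_holds hX, fun p c hc hpp ↦
    HodgeTheory.Andre1996_motivatedClasses_le_algebraicClasses_of_standardConjectureB_holds_of hcup hB hX p
      (h n hX hK p c hc hpp)⟩

end Soldatenkov2022_hodgeClasses_motivated_K3HilbertType_or_kummerType

end Literature.AlgebraicGeometry.Hyperkaehler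

end
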